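import Mathlib
import Summits.Ventures.PercRepro.TriangleCapFourRowFourCap
import Summits.Ventures.PercRepro.TriangleCapThirdOrderEleven
import Summits.Ventures.PercRepro.TriangleCapFourRowThree

/-!
# PercRepro — THE PIECES OF THE ROW `a = 4` AT `r = 4`: the side lemma of a deletion onto a `4`-bipartite `D − z`
(with the no-missing-star read of the `5`-bipartite case) and the arithmetic of the five deletions (p3, gen 46;
part 199q)

For part 199r on the cell `(k, 4, 4)` (`k ≥ 12`; target `Σ_v d(v)² + 4 (k − 5) + 4 ≤ m k`, the bipartite second-best
gap `2 (r − 2) = 4` of the brooms): a vertex `z` of degree `d ≤ 4` is deleted and `D − z` read on the cell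
`(k − 1, 4, d)`. Whenever `D − z` is `4`-bipartite with the `4`-side `A'` (`four_four_sides`): the neighbours of `z`
all in `A'` make `D` `4`-bipartite; all off `A'` make `D` `5`-bipartite with `k − 5` missing pairs which are NOT a star
(a missing pair of `D − z` is not at `z`, and `z` misses two vertices off `A'`), so `Σ_v d(v)² + 4 (k − 5) + 2 (k − 7)
≤ m k` (`closed_form_stability_bipSub`) — already below the target; otherwise a neighbour off `A'` has degree
`≤ 4` and `T ≤ (d − 1)(k − 6) + 4`. Axioms: standard.
-/

namespace PercRepro

namespace TriangleCap

namespace C047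

open Finset

variable {V : Type*} [Fintype V] [DecidableEq V]

/-- **THE SIDES OF A `4`-BIPARTITE `D − z` ON THE CELL `(k, 4, 4)`** (`1 ≤ d(z) ≤ 4`): `D` is `4`-bipartite, or below
the target, or a neighbour of `z` lies off the `4`-side and `T + (k − 6) ≤ d(z) (k − 6) + 4`. -/
theorem four_four_sides (D : SimpleGraph V) [DecidableRel D.Adj] (hk : 12 ≤ Fintype.card V)
    (hm : D.edgeFinset.card + 4 = 4 * (Fintype.card V - 4)) (z : V) (hz1 : 1 ≤ deg D z) (hz4 : deg D z ≤ 4)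
    (A' : Finset {v : V // v ≠ z}) (hA'card : A'.card = 4) (hB : BipSub (del D z) A')
    (hm' : (del D z).edgeFinset.card + deg D z = 4 * (Fintype.card {v : V // v ≠ z} - 4))
    (hcap6 : ∀ v, deg D v ≤ (Fintype.card V - 6) + 1) :
    (∃ A : Finset V, A.card = 4 ∧ BipSub D A) ∨
      (∑ v, deg D v * deg D v + 4 * (Fintype.card V - 5) + 4 ≤ D.edgeFinset.card * Fintype.card V) ∨
      (∑ a : {v : V // v ≠ z}, (if D.Adj a.1 z then deg (del D z) a else 0) + (Fintype.card V - 6) ≤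
        deg D z * (Fintype.card V - 6) + 4) := by
  have hcard' := card_del z
  by_cases hall : ∀ a : {v : V // v ≠ z}, D.Adj a.1 z → a ∈ A'
  · obtain ⟨B, hBcard, hBsub⟩ := bipSub_lift D z A' hB hall
    exact Or.inl ⟨B, by rw [hBcard, hA'card], hBsub⟩
  by_cases hnone : ∀ a : {v : V // v ≠ z}, D.Adj a.1 z → a ∉ A'
  · right; left
    have hAsub := bipSub_insert_map D z A' hB hnone
    have hAcard := card_insert_map z A'
    rw [hA'card] at hAcard
    obtain ⟨p, q, hp, hq, hpq⟩ := exists_missing_pair (del D z) A' hB 4 (deg D z) hA'card hm' hz1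
    obtain ⟨w₁, w₂, h12, hw₁, hw₂, hw₁z, hw₂z⟩ := exists_two_nonnbhd_off D z A' (by omega)
    have hns := not_missingStar_insert D z A' p q hp hq (fun h => hpq ((del_adj D z p q).mpr h)) w₁ w₂ h12 hw₁ hw₂
      hw₁z hw₂z
    have h := closed_form_stability_bipSub D _ hAsub 5 (Fintype.card V - 5) hAcard (by omega) (by omega)
      (by omega) hns
    have e : Fintype.card V - 1 - (Fintype.card V - 5) = 4 := by omega
    rw [e] at h
    omega
  · right; right
    push Not at hall
    obtain ⟨w₀, hw₀z, hw₀A⟩ := hall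
    obtain ⟨Nz, hNzdef⟩ : ∃ Nz : Finset {v : V // v ≠ z},
        Nz = univ.filter (fun a : {v : V // v ≠ z} => D.Adj a.1 z) := ⟨_, rfl⟩
    have hmemNz : ∀ a : {v : V // v ≠ z}, a ∈ Nz ↔ D.Adj a.1 z := fun a => by
      rw [hNzdef, mem_filter]
      simp only [mem_univ, true_and]
    have hNz : Nz.card = deg D z := by rw [hNzdef]; exact card_nbhd_del D z
    have hTfilt : ∑ a : {v : V // v ≠ z}, (if D.Adj a.1 z then deg (del D z) a else 0) =
        ∑ a ∈ Nz, deg (del D z) a := by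
      rw [hNzdef, sum_filter]
    rw [hTfilt, ← hNz]
    have hdw₀ : deg (del D z) w₀ ≤ 4 := by
      have := deg_le_card_of_bipSub (del D z) A' hB w₀ hw₀A
      rw [hA'card] at this
      exact this
    exact sum_le_of_mem_le Nz (fun a => deg (del D z) a) (Fintype.card V - 6) ((hmemNz w₀).mpr hw₀z)
      (fun a ha => by
        have h := deg_del D z a
        rw [if_pos ((hmemNz a).mp ha)] at h
        have := hcap6 a.1
        omega) hdw₀

/-- `d = 0`, `D − z` not `4`-bipartite on the diagonal `(k − 1, 4, 0)`: `S' + 8 (k − 10) ≤ m (k − 1)`. -/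
theorem four_four_del_zero_arith (s m' S' T : ℕ) (hm' : m' = 4 * s + 28)
    (hS' : S' + 2 * 4 * (s + 11 - 2 * 4 - 1) ≤ m' * (s + 11)) (hT : T ≤ 0 * (s + 12 - 6)) :
    S' + 2 * T + 0 + 0 * 0 + 4 * (s + 12 - 5) + 4 ≤ (m' + 0) * (s + 12) := by
  subst hm'
  have e1 : s + 11 - 2 * 4 - 1 = s + 2 := by omega
  have e2 : s + 12 - 5 = s + 7 := by omega
  rw [e1] at hS'
  rw [e2]
  have hT0 : T = 0 := by omega
  subst hT0
  nlinarith [hS']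

/-- `d = 1`, `D − z` not `4`-bipartite on `(k − 1, 4, 1)`: `S' + (k − 3) + 6 (k − 10) ≤ m' (k − 1)`, `T ≤ k − 6`. -/
theorem four_four_del_one_gap_arith (s m' S' T : ℕ) (hm' : m' = 4 * s + 27)
    (hS' : S' + (s + 11 - 2) + 2 * (s + 11 - 2 * 4 - 1) * (4 - 1) ≤ m' * (s + 11)) (hT : T ≤ 1 * (s + 12 - 6)) :
    S' + 2 * T + 1 + 1 * 1 + 4 * (s + 12 - 5) + 4 ≤ (m' + 1) * (s + 12) := by
  subst hm'
  have e0 : s + 11 - 2 = s + 9 := by omega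
  have e1 : s + 11 - 2 * 4 - 1 = s + 2 := by omega
  have e2 : s + 12 - 5 = s + 7 := by omega
  have e4 : s + 12 - 6 = s + 6 := by omega
  rw [e0, e1] at hS'
  rw [e4] at hT
  rw [e2]
  nlinarith [hS', hT]

/-- `d = 2`, mixed onto a `4`-bipartite `D − z` on `(k − 1, 4, 2)`: `S' + 2 (k − 4) ≤ m' (k − 1)`,
`T + (k − 6) ≤ 2 (k − 6) + 4`. -/
theorem four_four_del_two_mixed_arith (s m' S' T : ℕ) (hm' : m' = 4 * s + 26)
    (hS' : S' + 2 * (s + 11 - 1 - 2) ≤ m' * (s + 11)) (hT : T + (s + 12 - 6) ≤ 2 * (s + 12 - 6) + 4) :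
    S' + 2 * T + 2 + 2 * 2 + 4 * (s + 12 - 5) + 4 ≤ (m' + 2) * (s + 12) := by
  subst hm'
  have e1 : s + 11 - 1 - 2 = s + 8 := by omega
  have e2 : s + 12 - 5 = s + 7 := by omega
  have e4 : s + 12 - 6 = s + 6 := by omega
  rw [e1] at hS'
  rw [e4] at hT
  rw [e2]
  nlinarith [hS', hT]

/-- `d = 2`, `D − z` not `4`-bipartite on `(k − 1, 4, 2)`: `S' + 2 (k − 4) + 2 (k − 10) ≤ m' (k − 1)`,
`T ≤ 2 (k − 6)`. -/
theorem four_four_del_two_gap_arith (s m' S' T : ℕ) (hm' : m' = 4 * s + 26)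
    (hS' : S' + 2 * (s + 11 - 3) + 2 * (s + 11 - 9) ≤ m' * (s + 11)) (hT : T ≤ 2 * (s + 12 - 6)) :
    S' + 2 * T + 2 + 2 * 2 + 4 * (s + 12 - 5) + 4 ≤ (m' + 2) * (s + 12) := by
  subst hm'
  have e0 : s + 11 - 3 = s + 8 := by omega
  have e1 : s + 11 - 9 = s + 2 := by omega
  have e2 : s + 12 - 5 = s + 7 := by omega
  have e4 : s + 12 - 6 = s + 6 := by omega
  rw [e0, e1] at hS'
  rw [e4] at hT
  rw [e2]
  nlinarith [hS', hT]

/-- `d = 3`, mixed onto a `4`-bipartite `D − z` on `(k − 1, 4, 3)`: `S' + 3 (k − 5) ≤ m' (k − 1)`,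
`T + (k − 6) ≤ 3 (k − 6) + 4`. -/
theorem four_four_del_three_mixed_arith (s m' S' T : ℕ) (hm' : m' = 4 * s + 25)
    (hS' : S' + 3 * (s + 11 - 1 - 3) ≤ m' * (s + 11)) (hT : T + (s + 12 - 6) ≤ 3 * (s + 12 - 6) + 4) :
    S' + 2 * T + 3 + 3 * 3 + 4 * (s + 12 - 5) + 4 ≤ (m' + 3) * (s + 12) := by
  subst hm'
  have e1 : s + 11 - 1 - 3 = s + 7 := by omega
  have e2 : s + 12 - 5 = s + 7 := by omega
  have e4 : s + 12 - 6 = s + 6 := by omega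
  rw [e1] at hS'
  rw [e4] at hT
  rw [e2]
  nlinarith [hS', hT]

/-- `d = 3`, `D − z` not `4`-bipartite on `(k − 1, 4, 3)`: `S' + 3 (k − 5) + (2k − 20) ≤ m' (k − 1)`, `T ≤ 3 (k − 6)`. -/
theorem four_four_del_three_gap_arith (s m' S' T : ℕ) (hm' : m' = 4 * s + 25)
    (hS' : S' + 3 * (s + 11 - 4) + (2 * (s + 11) - 18) ≤ m' * (s + 11)) (hT : T ≤ 3 * (s + 12 - 6)) :
    S' + 2 * T + 3 + 3 * 3 + 4 * (s + 12 - 5) + 4 ≤ (m' + 3) * (s + 12) := by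
  subst hm'
  have e0 : s + 11 - 4 = s + 7 := by omega
  have e1 : 2 * (s + 11) - 18 = 2 * s + 4 := by omega
  have e2 : s + 12 - 5 = s + 7 := by omega
  have e4 : s + 12 - 6 = s + 6 := by omega
  rw [e0, e1] at hS'
  rw [e4] at hT
  rw [e2]
  nlinarith [hS', hT]

/-- `d = 4`, mixed onto a `4`-bipartite `D − z` on `(k − 1, 4, 4)`: `S' + 4 (k − 6) ≤ m' (k − 1)`,
`T + (k − 6) ≤ 4 (k − 6) + 4`. -/
theorem four_four_del_four_mixed_arith (s m' S' T : ℕ) (hm' : m' = 4 * s + 24)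
    (hS' : S' + 4 * (s + 11 - 1 - 4) ≤ m' * (s + 11)) (hT : T + (s + 12 - 6) ≤ 4 * (s + 12 - 6) + 4) :
    S' + 2 * T + 4 + 4 * 4 + 4 * (s + 12 - 5) + 4 ≤ (m' + 4) * (s + 12) := by
  subst hm'
  have e1 : s + 11 - 1 - 4 = s + 6 := by omega
  have e2 : s + 12 - 5 = s + 7 := by omega
  have e4 : s + 12 - 6 = s + 6 := by omega
  rw [e1] at hS'
  rw [e4] at hT
  rw [e2]
  nlinarith [hS', hT]

/-- `d = 4`, `D − z` not `4`-bipartite on `(k − 1, 4, 4)` at the induction hypothesis: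
`S' + 4 (k − 6) + 4 ≤ m' (k − 1)`, `T ≤ 4 (k − 6)`: exact. -/
theorem four_four_del_four_gap_arith (s m' S' T : ℕ) (hm' : m' = 4 * s + 24)
    (hS' : S' + 4 * (s + 11 - 5) + 4 ≤ m' * (s + 11)) (hT : T ≤ 4 * (s + 12 - 6)) :
    S' + 2 * T + 4 + 4 * 4 + 4 * (s + 12 - 5) + 4 ≤ (m' + 4) * (s + 12) := by
  subst hm'
  have e0 : s + 11 - 5 = s + 6 := by omega
  have e2 : s + 12 - 5 = s + 7 := by omega
  have e4 : s + 12 - 6 = s + 6 := by omega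
  rw [e0] at hS'
  rw [e4] at hT
  rw [e2]
  nlinarith [hS', hT]

end C047

end TriangleCap

end PercRepro
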